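import Summits.ABC.IUTFork.Cor312IdentifiedNonVacuitySigns
import Mathlib.Analysis.SpecificLimits.Basic
import HarnessLib

/-!
# [IUTchIII] Corollary 3.12 — the SCALED-COPIES (faithful-computation) witness at the verbatim setting,
# I: the valuation frame on the sign-shell packets

Record-only file (D-0012) of the abc-iut cell (D-0067 overnight push, wave-4 prover abc-iut-w4-d101, piece
R-SC for Cor. 3.12 STRATEGY TEAM R; companion of the R-NV files `Cor312IdentifiedNonVacuity*`); TAKES NO SIDE.
Scholze–Stix locate the dispute over [IUTchIII] Cor. 3.12 in a dichotomy ([cite: ScholzeStix2018, §2.1.8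
pp. 8–9, §2.2 pp. 9–10]): EITHER the copies of the pilot objects are identified along the identity — then
`−|log(Θ)| = −|log(q)|` and the Corollary is true but contentless (Team R R-1 `Cor312.Setting.IdentifiedReading`,
made non-vacuous by R-NV) — OR the identification is scaled by `j²` to "encode the arithmetic degree of the
j-th concrete Θ-pilot object" — then the computation is faithful and the inequality FAILS by the Step (v)
weight `(ℓ⋇+1)(2ℓ⋇+1)/6`. This file and its sequel (`Cor312ScaledCopiesWitness`) realise the SECOND horn as a
NON-DEGENERATE kernel witness on the frozen verbatim `Cor312.Setting` (c312-7), over the SAME packets and the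
SAME non-trivially acting (Ind1)(Ind2)-group as R-NV (the sign shells of `Cor312IdentifiedNonVacuitySigns`):

* `ballR k` — the nested VALUATION BALLS `{x | |line x| ≤ 2^{-k}}` of a packet line (`ballR 0` = R-NV's `ball`):
  nonempty, strictly decreasing in `k` (`ballR_subset_ballR_iff`), never everything, and FIXED AS SETS by every
  element of the (Ind1)(Ind2)-group (`image_ballR_of_actsBySigns` — signs preserve `|line x|`).
* `depth` / `ssVol` — a FAITHFUL valuation log-volume: `ssVol (ballR k) = −k`, `ssVol univ = 0`, monotone on
  non-degenerate regions (`ssVol_mono`); `SSAdm` — non-degeneracy (the region contains a point off the origin).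
* `valFrame` — the hull frame whose hull-sets are the balls and everything (every hull-set is its own hull);
  `ssData`, `ssDegrees`, `ssSituation` — the data (a)(b)(c) of Thm. 3.11 (i) on these packets.

HONEST SCOPE. Toy carriers (one place, `ℚ`-line packets); the valuation volume is a faithful MODEL of
"log-volume of `q^k·𝒪`", not the real Haar volume of the assembled real setting. Nothing here bears on which
reading of [IUTchIII] Thm. 3.11 / Cor. 3.12 Step (xi) is right. [claim: Mochizuki2012, status: disputed] for the
Corollary. No new `Prop` facts; standard axioms.
-/

noncomputable section

namespace Summit.ABC.IUTFork.Cor312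

namespace ScaledCopies

open Thm311 Cor312.Checks IdentifiedNonVacuity Literature.IUT.LogThetaLattice

/-! ## 1. Valuation balls on a packet line -/

/-- The radius `2^{-k}`. [folklore] -/
def radius (k : ℕ) : ℚ := ((2 : ℚ) ^ k)⁻¹

/-- The radius is positive. [folklore] -/
theorem radius_pos (k : ℕ) : 0 < radius k := by unfold radius; positivity

/-- The radii are strictly decreasing. [folklore] -/
theorem radius_lt_radius {k k' : ℕ} (h : k < k') : radius k' < radius k := by
  unfold radius
  exact inv_strictAnti₀ (by positivity) (pow_lt_pow_right₀ (by norm_num) h)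

/-- The radii are (weakly) decreasing. [folklore] -/
theorem radius_le_radius {k k' : ℕ} (h : k ≤ k') : radius k' ≤ radius k := by
  rcases h.eq_or_lt with rfl | h
  · exact le_rfl
  · exact (radius_lt_radius h).le

/-- The VALUATION BALL of depth `k` of the packet at `(j, v_ℚ)`: `{x | |line x| ≤ 2^{-k}}` — the model of
`q^k · 𝒪` in a packet line. [folklore] -/
def ballR (k : ℕ) (j : toyIndex.Label) (vQ : toyIndex.VQ) : Set (signShells.Packet j vQ) :=
  {x | |line j vQ x| ≤ radius k}

/-- The depth-`0` ball is R-NV's unit ball. [folklore] -/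
theorem ballR_zero (j : toyIndex.Label) (vQ : toyIndex.VQ) : ballR 0 j vQ = ball j vQ := by
  ext x
  simp only [ballR, radius, pow_zero, inv_one, Set.mem_setOf_eq]
  rfl

/-- `0` lies in every ball. [folklore] -/
theorem zero_mem_ballR (k : ℕ) (j : toyIndex.Label) (vQ : toyIndex.VQ) :
    (0 : signShells.Packet j vQ) ∈ ballR k j vQ := by
  show |line j vQ 0| ≤ radius k
  rw [map_zero, abs_zero]; exact (radius_pos k).le

/-- Every ball is nonempty. [folklore] -/
theorem ballR_nonempty (k : ℕ) (j : toyIndex.Label) (vQ : toyIndex.VQ) : (ballR k j vQ).Nonempty :=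
  ⟨0, zero_mem_ballR k j vQ⟩

/-- The point of line coordinate `2^{-k}`. [folklore] -/
def pt (k : ℕ) (j : toyIndex.Label) (vQ : toyIndex.VQ) : signShells.Packet j vQ := (line j vQ).symm (radius k)

/-- Its line coordinate. [folklore] -/
theorem line_pt (k : ℕ) (j : toyIndex.Label) (vQ : toyIndex.VQ) : line j vQ (pt k j vQ) = radius k :=
  LinearEquiv.apply_symm_apply _ _

/-- … is nonzero. [folklore] -/
theorem line_pt_ne_zero (k : ℕ) (j : toyIndex.Label) (vQ : toyIndex.VQ) : line j vQ (pt k j vQ) ≠ 0 := by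
  rw [line_pt]; exact (radius_pos k).ne'

/-- The point of coordinate `2^{-k}` lies in the ball of depth `k` … [folklore] -/
theorem pt_mem_ballR (k : ℕ) (j : toyIndex.Label) (vQ : toyIndex.VQ) : pt k j vQ ∈ ballR k j vQ := by
  show |line j vQ (pt k j vQ)| ≤ radius k
  rw [line_pt, abs_of_pos (radius_pos k)]

/-- … and in a ball of depth `k'` iff `k' ≤ k`. [folklore] -/
theorem pt_mem_ballR_iff {k k' : ℕ} (j : toyIndex.Label) (vQ : toyIndex.VQ) :
    pt k j vQ ∈ ballR k' j vQ ↔ k' ≤ k := by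
  show |line j vQ (pt k j vQ)| ≤ radius k' ↔ _
  rw [line_pt, abs_of_pos (radius_pos k)]
  constructor
  · intro h
    by_contra hlt
    exact absurd h (not_le_of_gt (radius_lt_radius (not_le.mp hlt)))
  · exact radius_le_radius

/-- The balls are nested: depth `k' ≥ k` gives a smaller ball. [folklore] -/
theorem ballR_anti {k k' : ℕ} (h : k ≤ k') (j : toyIndex.Label) (vQ : toyIndex.VQ) :
    ballR k' j vQ ⊆ ballR k j vQ :=
  fun _ hx => le_trans hx (radius_le_radius h)

/-- … and conversely: `ballR k ⊆ ballR k'` iff `k' ≤ k`. [folklore] -/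
theorem ballR_subset_ballR_iff {k k' : ℕ} (j : toyIndex.Label) (vQ : toyIndex.VQ) :
    ballR k j vQ ⊆ ballR k' j vQ ↔ k' ≤ k :=
  ⟨fun h => (pt_mem_ballR_iff j vQ).mp (h (pt_mem_ballR k j vQ)), fun h => ballR_anti h j vQ⟩

/-- Distinct depths give distinct balls. [folklore] -/
theorem ballR_ne_of_ne {k k' : ℕ} (h : k ≠ k') (j : toyIndex.Label) (vQ : toyIndex.VQ) :
    ballR k j vQ ≠ ballR k' j vQ := by
  intro he
  have h1 : k' ≤ k := (ballR_subset_ballR_iff j vQ).mp he.subset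
  have h2 : k ≤ k' := (ballR_subset_ballR_iff j vQ).mp he.symm.subset
  exact h (le_antisymm h2 h1)

/-- No ball is everything (the point of coordinate `2` lies outside the unit ball). [folklore] -/
theorem univ_not_subset_ballR (k : ℕ) (j : toyIndex.Label) (vQ : toyIndex.VQ) :
    ¬ (Set.univ : Set (signShells.Packet j vQ)) ⊆ ballR k j vQ := by
  intro h
  have h2 : |line j vQ ((line j vQ).symm 2)| ≤ radius k := h (Set.mem_univ _)
  rw [LinearEquiv.apply_symm_apply] at h2
  have h3 : radius k ≤ radius 0 := radius_le_radius (Nat.zero_le k)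
  rw [show radius 0 = 1 by simp [radius]] at h3
  norm_num at h2
  linarith [abs_of_pos (show (0:ℚ) < 2 by norm_num)]

/-- A family acting by signs FIXES every valuation ball (as a set): signs do not change `|line x|`. Hence
every element of the (Ind1)(Ind2)-group does (`IdentifiedNonVacuity.actsBySigns_of_mem_closure`). [folklore] -/
theorem image_ballR_of_actsBySigns {Φ : signShells.PacketAut} (h : ActsBySigns Φ) (k : ℕ)
    (j : toyIndex.Label) (vQ : toyIndex.VQ) : Φ j vQ '' ballR k j vQ = ballR k j vQ := by
  obtain ⟨ε, hε, hΦ⟩ := h.sign j vQ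
  apply Set.Subset.antisymm
  · rintro _ ⟨x, hx, rfl⟩
    show |line j vQ (Φ j vQ x)| ≤ radius k
    rw [hΦ, abs_mul, hε, one_mul]; exact hx
  · intro x hx
    refine ⟨(Φ j vQ).symm x, ?_, LinearEquiv.apply_symm_apply _ _⟩
    have h1 := hΦ ((Φ j vQ).symm x)
    rw [LinearEquiv.apply_symm_apply] at h1
    show |line j vQ ((Φ j vQ).symm x)| ≤ radius k
    have h2 : |line j vQ x| = |line j vQ ((Φ j vQ).symm x)| := by rw [h1, abs_mul, hε, one_mul]
    rw [← h2]; exact hx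

/-! ## 2. The faithful valuation log-volume -/

/-- NON-DEGENERACY of a region: it contains a point off the origin of the line (the admissible regions of
the witness; every ball and the whole packet are non-degenerate, `{0}` and `∅` are not). [folklore] -/
@[folklore] def SSAdm (j : toyIndex.Label) (vQ : toyIndex.VQ) (A : Set (signShells.Packet j vQ)) : Prop :=
  ∃ x ∈ A, line j vQ x ≠ 0

/-- Balls are non-degenerate. [folklore] -/
theorem ssAdm_ballR (k : ℕ) (j : toyIndex.Label) (vQ : toyIndex.VQ) : SSAdm j vQ (ballR k j vQ) :=
  ⟨pt k j vQ, pt_mem_ballR k j vQ, line_pt_ne_zero k j vQ⟩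

/-- The whole packet is non-degenerate. [folklore] -/
theorem ssAdm_univ (j : toyIndex.Label) (vQ : toyIndex.VQ) : SSAdm j vQ Set.univ :=
  ⟨pt 0 j vQ, Set.mem_univ _, line_pt_ne_zero 0 j vQ⟩

/-- Non-degeneracy is monotone. [folklore] -/
theorem SSAdm.mono {j : toyIndex.Label} {vQ : toyIndex.VQ} {A B : Set (signShells.Packet j vQ)}
    (hA : SSAdm j vQ A) (hAB : A ⊆ B) : SSAdm j vQ B := by
  obtain ⟨x, hx, h⟩ := hA; exact ⟨x, hAB hx, h⟩

/-- The set of depths of balls containing a region. [folklore] -/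
def depths (j : toyIndex.Label) (vQ : toyIndex.VQ) (A : Set (signShells.Packet j vQ)) : Set ℕ :=
  {k | A ⊆ ballR k j vQ}

/-- For a non-degenerate region the depths are bounded (a point off the origin escapes deep balls). [folklore] -/
theorem depths_bddAbove {j : toyIndex.Label} {vQ : toyIndex.VQ} {A : Set (signShells.Packet j vQ)}
    (hA : SSAdm j vQ A) : BddAbove (depths j vQ A) := by
  obtain ⟨x, hx, h0⟩ := hA
  have hpos : 0 < |line j vQ x| := abs_pos.mpr h0
  obtain ⟨K, hK⟩ := exists_pow_lt_of_lt_one hpos (show ((2:ℚ)⁻¹) < 1 by norm_num)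
  refine ⟨K, fun k hk => ?_⟩
  by_contra hlt
  have h1 : |line j vQ x| ≤ radius k := hk hx
  have h2 : radius k ≤ radius K := radius_le_radius (not_le.mp hlt).le
  have h3 : radius K = (2:ℚ)⁻¹ ^ K := by simp [radius, inv_pow]
  linarith

/-- The DEPTH of a region: the largest `k` with `A ⊆ ballR k` (`0` if none, or if unbounded). [folklore] -/
def depth (j : toyIndex.Label) (vQ : toyIndex.VQ) (A : Set (signShells.Packet j vQ)) : ℕ :=
  sSup (depths j vQ A)

/-- The depth of the ball of depth `k` is `k`. [folklore] -/
theorem depth_ballR (k : ℕ) (j : toyIndex.Label) (vQ : toyIndex.VQ) : depth j vQ (ballR k j vQ) = k := by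
  have h : depths j vQ (ballR k j vQ) = Set.Iic k := by
    ext k'
    exact ballR_subset_ballR_iff j vQ
  unfold depth
  rw [h, csSup_Iic]

/-- The depth of the whole packet is `0` (it lies in no ball). [folklore] -/
theorem depth_univ (j : toyIndex.Label) (vQ : toyIndex.VQ) :
    depth j vQ (Set.univ : Set (signShells.Packet j vQ)) = 0 := by
  have h : depths j vQ (Set.univ : Set (signShells.Packet j vQ)) = ∅ :=
    Set.eq_empty_of_forall_notMem fun k hk => univ_not_subset_ballR k j vQ hk
  unfold depth
  rw [h, csSup_empty]
  rfl

/-- The depth is ANTITONE on non-degenerate regions. [folklore] -/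
theorem depth_anti {j : toyIndex.Label} {vQ : toyIndex.VQ} {A B : Set (signShells.Packet j vQ)}
    (hA : SSAdm j vQ A) (hAB : A ⊆ B) : depth j vQ B ≤ depth j vQ A := by
  by_cases hB : (depths j vQ B).Nonempty
  · exact csSup_le_csSup (depths_bddAbove hA) hB fun k hk => hAB.trans hk
  · unfold depth
    rw [Set.not_nonempty_iff_eq_empty.mp hB, csSup_empty]
    exact bot_le

/-- **The FAITHFUL VALUATION LOG-VOLUME** of the witness: minus the depth ("`log-vol(q^k·𝒪) = −k·log`",
normalised with `log := 1`). [folklore] -/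
def ssVol (j : toyIndex.Label) (vQ : toyIndex.VQ) (A : Set (signShells.Packet j vQ)) : ℝ :=
  -(depth j vQ A : ℝ)

/-- The log-volume of the ball of depth `k` is `−k`. [folklore] -/
theorem ssVol_ballR (k : ℕ) (j : toyIndex.Label) (vQ : toyIndex.VQ) : ssVol j vQ (ballR k j vQ) = -(k : ℝ) := by
  rw [ssVol, depth_ballR]

/-- The log-volume of the whole packet is `0`. [folklore] -/
theorem ssVol_univ (j : toyIndex.Label) (vQ : toyIndex.VQ) :
    ssVol j vQ (Set.univ : Set (signShells.Packet j vQ)) = 0 := by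
  rw [ssVol, depth_univ]; simp

/-- The log-volume is MONOTONE on non-degenerate regions. [folklore] -/
theorem ssVol_mono {j : toyIndex.Label} {vQ : toyIndex.VQ} {A B : Set (signShells.Packet j vQ)}
    (hA : SSAdm j vQ A) (hAB : A ⊆ B) : ssVol j vQ A ≤ ssVol j vQ B := by
  unfold ssVol
  have := depth_anti hA hAB
  exact neg_le_neg (by exact_mod_cast this)

/-! ## 3. The valuation hull frame and the data of Theorem 3.11 (i) -/

/-- The hull-sets: every valuation ball, and everything. [folklore] -/
def hulR (j : toyIndex.Label) (vQ : toyIndex.VQ) : Set (Set (signShells.Packet j vQ)) :=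
  insert Set.univ (Set.range fun k => ballR k j vQ)

/-- Balls are hull-sets. [folklore] -/
theorem ballR_mem_hulR (k : ℕ) (j : toyIndex.Label) (vQ : toyIndex.VQ) : ballR k j vQ ∈ hulR j vQ :=
  Set.mem_insert_of_mem _ ⟨k, rfl⟩

/-- Everything is a hull-set. [folklore] -/
theorem univ_mem_hulR (j : toyIndex.Label) (vQ : toyIndex.VQ) : Set.univ ∈ hulR j vQ := Set.mem_insert _ _

/-- Hull-sets are non-degenerate … [folklore] -/
theorem ssAdm_of_mem_hulR {j : toyIndex.Label} {vQ : toyIndex.VQ} {H : Set (signShells.Packet j vQ)}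
    (hH : H ∈ hulR j vQ) : SSAdm j vQ H := by
  rcases hH with rfl | ⟨k, rfl⟩
  · exact ssAdm_univ j vQ
  · exact ssAdm_ballR k j vQ

/-- … and contain `0` (so are nonempty). [folklore] -/
theorem zero_mem_of_mem_hulR {j : toyIndex.Label} {vQ : toyIndex.VQ} {H : Set (signShells.Packet j vQ)}
    (hH : H ∈ hulR j vQ) : (0 : signShells.Packet j vQ) ∈ H := by
  rcases hH with rfl | ⟨k, rfl⟩
  · exact Set.mem_univ _
  · exact zero_mem_ballR k j vQ

/-- The VALUATION HULL FRAME: hull-sets = balls and everything, every region relatively compact, a region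
"admits its hull" iff it is itself a hull-set (then it is its own hull — the only case the witness needs).
[folklore] -/
def valFrame (j : toyIndex.Label) (vQ : toyIndex.VQ) : HullFrame (signShells.Packet j vQ) where
  Hul := hulR j vQ
  IsBounded := fun _ => True
  HasHull := fun U => U ∈ hulR j vQ
  hul_bounded := fun _ _ => trivial
  bounded_mono := fun _ _ _ _ => trivial
  exists_hul := fun _ _ => ⟨Set.univ, univ_mem_hulR j vQ, Set.subset_univ _⟩
  hull_mem := fun U _ hU => by
    have h : ⋂₀ {H | H ∈ hulR j vQ ∧ U ⊆ H} = U :=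
      Set.Subset.antisymm (Set.sInter_subset_of_mem ⟨hU, subset_rfl⟩) (Set.subset_sInter fun H hH => hH.2)
    rw [h]; exact hU

/-- Data (a)(b)(c) of the scaled-copies witness: non-degenerate regions admissible, the faithful valuation
log-volume, integral structure the unit ball, no splitting monoid, no number field. [folklore] -/
def ssData : MRData signShells where
  shellPk := fun j vQ => ballR 0 j vQ
  shellSub := fun _ _ => Set.univ
  Adm := fun j vQ A => SSAdm j vQ A
  logvol := fun j vQ A => ssVol j vQ A
  Ψ := fun _ _ => ∅
  act := fun _ _ _ => 0
  Mmod := fun _ => ∅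

/-- One Frobenioid object of degree `0` whose region is everything. [folklore] -/
def ssDegrees (j : toyIndex.LabelStar) : GlobalDegrees signShells j where
  ObjMOD := Unit
  Objmod := Unit
  natIso := Equiv.refl Unit
  deg := fun _ => 0
  region := fun _ _ => Set.univ

/-- The witness SITUATION: the sign shells with the valuation data on every vertical line. [folklore] -/
def ssSituation : Situation toyIndex where
  L := signShells
  D := fun _ => ssData
  G := fun _ j => ssDegrees j

end ScaledCopies

end Summit.ABC.IUTFork.Cor312

end
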